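import Literature.NumberTheory.EllipticCurves.KatoRankBoundAllPrimesProofs
import Literature.NumberTheory.EllipticCurves.KatoDivisibilitySkeletonProofs
import HarnessLib

/-!
# Kato's Thm 18.4 at every prime: the §17.13 skeleton with Poitou–Tate exact "upto ×2"

Companion to `Literature.NumberTheory.EllipticCurves.KatoRankBoundAllPrimesProofs` (the reduction
of K. Kato, Astérisque 295 (2004), Thm 18.4 at EVERY good ordinary prime — named fact
`Literature.NumberTheory.EllipticCurves.kato_selmerCorank_le_order_padicLFunction_allPrimes` — to
Kato's Thm 17.4 (1)(2) at that prime) and to `KatoDivisibilitySkeletonProofs` (the module theory of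
Kato's §17.13 proving Thm 17.4 (1)(2) from four cohomological inputs, for EXACT sequences).

What is specific to `p = 2` in Kato's printed proof of Thm 17.4 (and hence of Thm 18.4) is one
thing: the Poitou–Tate sequences (14.9.1)–(14.9.4) and therefore (17.13.1)
`0 → H¹(T(k))/lim H¹_f → H¹_loc(T(k))/lim H¹_f → X(T*(1-k)) → H²(T(k)) → H²_loc(T(k))`
are "exact in the case `p ≠ 2`, and exact upto `×2` in the case `p = 2`" (p. 239, p. 240,
p. 279), where (p. 239) "a sequence `… → C_i →f_i C_{i+1} →f_{i+1} …` is exact upto `×2` if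
`2 · Image(f_i) ⊂ Ker(f_{i+1})` and `2 · Ker(f_{i+1}) ⊂ Image(f_i)` for all `i`". Kato then
localises at a height-one prime `𝔭` of `Λ`: "In the case `𝔭` contains `p`, we assume `p ≠ 2` …
By (17.13.2)–(17.13.4), we obtain from (17.13.1) an exact sequence
`0 → H¹(T(k))_𝔭 → H¹_loc(T(k))_𝔭/H¹_loc(T'(k))_𝔭 → X(T*(1-k))_𝔭 → H²(T(k))_𝔭 → 0`" (p. 280) — at
`𝔭 ∌ p` the defect, killed by `2 = p`, dies in `Λ_𝔭`. The tree's skeleton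
(`Kato2004.thm17_4_skeleton`, file `KatoDivisibilitySkeletonProofs`) records in its docstring that
this "exactness up to `×2` for `p = 2`" is deliberately not treated there ("the consumers assume
`p ≠ 2`"). The all-primes fact is precisely the consumer that needs it, and this file PROVES it:

* `Module.lengthAt_eq_zero_of_smul_eq_zero`, `Module.lengthAt_le_of_smul_mem`,
  `Module.lengthAt_quotient_le_of_smul_mem`, `Module.lengthAt_le_add_of_smul_ker_le` — local
  lengths at `𝔭` do not see defects killed by an element `c ∉ 𝔭` (localisation at `𝔭` inverts `c`).
* `Kato2004.isTorsion_of_skeleton_upTo`, `Kato2004.lengthAt_le_of_skeleton_upTo`,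
  `Kato2004.thm17_4_skeleton_upTo` — Thm 17.4 (1)(2) in Kato's printed (length) form over any
  domain, from the four inputs of §17.13 with the Poitou–Tate maps `H → P → X → H2` only exact
  up to `×c` (`c ≠ 0`; the length inequality at the primes `𝔭 ∌ c`).
* `Kato2004.exists_mem_charIdeal_of_skeleton_upTo` — over `Λ = ℤ_p⟦T⟧`, the tree's form
  "`X` torsion and `p^m L ∈ ι(char_Λ X)`", for any `c` lying in no height-one prime `𝔭 ∌ p`
  (e.g. `c = p^a`; Kato: `c = 2 = p`).
* `Kato2004.kato_divisibility_conclusions_of_skeleton_upTo` — for `X = X(E/ℚ_∞) = D.X` and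
  `L = L_p(E,T)`: conclusions (1)(2) of Thm 17.4 at ANY prime `p`, defects killed by `p^a`.
* `kato_selmerCorank_le_order_padicLFunction_allPrimes_of_skeleton` — the conclusion of the
  all-primes fact, `corank_{ℤ_p} Sel_{p^∞}(E/ℚ) ≤ ord_{T=0} L_p(E,T)`, at ANY good ordinary prime
  `p` (`p = 2` included) from the four cohomological inputs of §17.13 on one cyclotomic datum with
  Poitou–Tate exact up to `×p^a` — i.e. the all-primes Thm 18.4 needs no input beyond those of
  the odd-`p` divisibility, uniformly in `p` (assembled with
  `selmerCorank_le_order_of_charIdeal_datum`).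

No definition and no named fact is introduced (D-0026); `H¹`, `H¹_loc`, the Coleman map and the
zeta elements remain hypotheses on abstract `Λ`-modules exactly as in `KatoDivisibilitySkeletonProofs`.

## References

* K. Kato, *`p`-adic Hodge theory and values of zeta functions of modular forms*, Astérisque 295
  (2004): 14.9 (pp. 239–240, "exact upto ×2"), Thm 17.4 (p. 273), §17.13 (pp. 279–280),
  Thm 18.4 and 18.5–18.10 (pp. 281–283).
* N. Bourbaki, *Algèbre commutative* II §2.4 (localisation is exact), VII §4.4–4.5.
-/

noncomputable section

open scoped MatrixGroups ModularForm

open CongruenceSubgroup Literature.NumberTheory.EllipticCurves.ModularForms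

namespace Literature.NumberTheory.EllipticCurves

/-! ### Local lengths ignore defects killed by an element outside `𝔭` -/

namespace Module

section Defect

variable {R : Type*} [CommRing R] {M N : Type*} [AddCommGroup M] [_root_.Module R M]
  [AddCommGroup N] [_root_.Module R N]

/-- If `M` is killed by some `c ∉ 𝔭` then `M_𝔭 = 0`, i.e. `lengthAt R M 𝔭 = 0` (`c` is a unit
of `R_𝔭`; Bourbaki AC II §2.4). [folklore] -/
theorem lengthAt_eq_zero_of_smul_eq_zero {c : R} (𝔭 : PrimeSpectrum R) (hc : c ∉ 𝔭.asIdeal)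
    (h : ∀ m : M, c • m = 0) : lengthAt R M 𝔭 = 0 := by
  rw [lengthAt_eq_zero_iff, LocalizedModule.subsingleton_iff]
  exact fun m => ⟨c, hc, h m⟩

/-- For submodules `K, N' ≤ M` with `c • K ⊆ N'` and `c ∉ 𝔭`: `length K_𝔭 ≤ length N'_𝔭`
(`K/(K ∩ N')` is killed by `c`, so `K_𝔭 = (K ∩ N')_𝔭 ⊆ N'_𝔭`). [folklore] -/
theorem lengthAt_le_of_smul_mem {K N' : Submodule R M} {c : R} (𝔭 : PrimeSpectrum R)
    (hc : c ∉ 𝔭.asIdeal) (h : ∀ k ∈ K, c • k ∈ N') : lengthAt R K 𝔭 ≤ lengthAt R N' 𝔭 := by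
  -- `φ : K → M/N'` has range killed by `c` and kernel `K ∩ N' ↪ N'`
  let φ : K →ₗ[R] M ⧸ N' := N'.mkQ ∘ₗ K.subtype
  have h1 : lengthAt R K 𝔭 =
      lengthAt R (LinearMap.ker φ) 𝔭 + lengthAt R (K ⧸ LinearMap.ker φ) 𝔭 :=
    lengthAt_eq_add_quotient _ 𝔭
  have h2 : lengthAt R (K ⧸ LinearMap.ker φ) 𝔭 = 0 := by
    rw [lengthAt_eq_of_linearEquiv φ.quotKerEquivRange 𝔭]
    refine lengthAt_eq_zero_of_smul_eq_zero 𝔭 hc ?_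
    rintro ⟨_, k, rfl⟩
    refine Subtype.ext ?_
    change c • φ k = 0
    rw [← map_smul]
    exact (Submodule.Quotient.mk_eq_zero N').mpr (h _ k.2)
  have h3 : lengthAt R (LinearMap.ker φ) 𝔭 ≤ lengthAt R N' 𝔭 := by
    refine lengthAt_le_of_injective
      (LinearMap.codRestrict N' (K.subtype ∘ₗ (LinearMap.ker φ).subtype) fun x => ?_) ?_ 𝔭
    · have hx : φ x.1 = 0 := x.2
      exact (Submodule.Quotient.mk_eq_zero N').mp hx
    · intro x y hxy
      apply Subtype.ext
      apply Subtype.ext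
      simpa using congrArg Subtype.val hxy
  rw [h1, h2, add_zero]
  exact h3

/-- For submodules `A, B ≤ M` with `c • A ⊆ B` and `c ∉ 𝔭`: `length (M/B)_𝔭 ≤ length (M/A)_𝔭`
(`M/B` is a quotient of `M/(A ∩ B)`, and `A/(A ∩ B)` is killed by `c`). [folklore] -/
theorem lengthAt_quotient_le_of_smul_mem {A B : Submodule R M} {c : R} (𝔭 : PrimeSpectrum R)
    (hc : c ∉ 𝔭.asIdeal) (h : ∀ a ∈ A, c • a ∈ B) :
    lengthAt R (M ⧸ B) 𝔭 ≤ lengthAt R (M ⧸ A) 𝔭 := by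
  have h1 : lengthAt R (M ⧸ B) 𝔭 ≤ lengthAt R (M ⧸ (A ⊓ B)) 𝔭 :=
    lengthAt_le_of_surjective (Submodule.factor inf_le_right) (Submodule.factor_surjective _) 𝔭
  have h2 : lengthAt R (M ⧸ (A ⊓ B)) 𝔭 = lengthAt R (Submodule.map (A ⊓ B).mkQ A) 𝔭 +
      lengthAt R ((M ⧸ (A ⊓ B)) ⧸ Submodule.map (A ⊓ B).mkQ A) 𝔭 :=
    lengthAt_eq_add_quotient _ 𝔭
  have h3 : lengthAt R (Submodule.map (A ⊓ B).mkQ A) 𝔭 = 0 := by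
    refine lengthAt_eq_zero_of_smul_eq_zero 𝔭 hc ?_
    rintro ⟨_, a, ha, rfl⟩
    refine Subtype.ext ?_
    change c • (A ⊓ B).mkQ a = 0
    rw [← map_smul, Submodule.mkQ_apply, Submodule.Quotient.mk_eq_zero]
    exact ⟨A.smul_mem c ha, h a ha⟩
  have h4 : lengthAt R ((M ⧸ (A ⊓ B)) ⧸ Submodule.map (A ⊓ B).mkQ A) 𝔭 = lengthAt R (M ⧸ A) 𝔭 :=
    lengthAt_eq_of_linearEquiv (Submodule.quotientQuotientEquivQuotient (A ⊓ B) A inf_le_left) 𝔭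
  rw [h2, h3, h4, zero_add] at h1
  exact h1

/-- Half-exactness up to `×c` bounds lengths: if `g : M → N` and a submodule `F ≤ M` satisfy
`c • Ker(g) ⊆ F` with `c ∉ 𝔭`, then `length M_𝔭 ≤ length F_𝔭 + length N_𝔭`. For `c = 1` and
`F = Image(f)` this is the usual bound for a pair exact at `M`. [folklore] -/
theorem lengthAt_le_add_of_smul_ker_le (g : M →ₗ[R] N) (F : Submodule R M) {c : R}
    (𝔭 : PrimeSpectrum R) (hc : c ∉ 𝔭.asIdeal) (h : ∀ x, g x = 0 → c • x ∈ F) :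
    lengthAt R M 𝔭 ≤ lengthAt R F 𝔭 + lengthAt R N 𝔭 := by
  rw [lengthAt_eq_add_quotient (LinearMap.ker g) 𝔭]
  refine add_le_add (lengthAt_le_of_smul_mem 𝔭 hc fun k hk => h k hk) ?_
  exact (lengthAt_eq_of_linearEquiv g.quotKerEquivRange 𝔭).trans_le
    (lengthAt_submodule_le (LinearMap.range g) 𝔭)

end Defect

end Module

/-! ### Kato §17.13 over a domain, with the Poitou–Tate maps exact up to `×c` -/

namespace Kato2004

open Module

section SkeletonUpTo

variable {R : Type*} [CommRing R] [IsDomain R]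
  {H P X H2 : Type*} [AddCommGroup H] [_root_.Module R H] [AddCommGroup P] [_root_.Module R P]
  [AddCommGroup X] [_root_.Module R X] [AddCommGroup H2] [_root_.Module R H2]

omit [IsDomain R] in
/-- With `col : P ↪ R` injective and `col (loc z) = G`: `G • y = col(y) • loc z` for every `y ∈ P`
(`P / loc(H)` is killed by `G`; Kato, §17.13, p. 280). [cite: Kato2004Asterisque, §17.13 (p. 280)] -/
theorem smul_eq_col_smul_loc (loc : H →ₗ[R] P) (col : P →ₗ[R] R)
    (hcol : Function.Injective col) {z : H} {G : R} (hz : col (loc z) = G) (y : P) :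
    G • y = col y • loc z := by
  apply hcol
  simp only [map_smul, hz, smul_eq_mul, mul_comm]

/-- **Thm. 17.4 (1), skeleton, Poitou–Tate exact up to `×c`.** Let `H →loc P →toX X →δ H2` be
linear maps with `c · toX(loc H) = 0` and `c · Ker(δ) ⊆ toX(P)` (the two halves of Kato's "(17.13.1)
is exact upto `×2`", p. 279, that the argument uses; p. 239 for the notion), `c ≠ 0`; let
`col : P ↪ R` be injective (Prop. 17.11) with `col (loc z) = G ≠ 0` (Thm. 16.6) and `H2` torsion
(Thm. 12.4 (1)). Then `X` is a torsion module: for `x ∈ X`, `a · δ x = 0` (`a ≠ 0`) gives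
`c a x = toX y`, `G y = col(y) loc z`, hence `c G c a · x = col(y) · c · toX(loc z) = 0`.
[cite: Kato2004Asterisque, Thm 17.4 (1) (p. 273), §17.13 (pp. 279–280), 14.9 (p. 239)] -/
theorem isTorsion_of_skeleton_upTo {c : R} (hc : c ≠ 0) (loc : H →ₗ[R] P) (toX : P →ₗ[R] X)
    (δ : X →ₗ[R] H2) (hPX : ∀ h : H, c • toX (loc h) = 0)
    (hXH : ∀ x : X, δ x = 0 → c • x ∈ LinearMap.range toX)
    (col : P →ₗ[R] R) (hcol : Function.Injective col) {z : H} {G : R} (hG : G ≠ 0)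
    (hz : col (loc z) = G) (hH2 : Module.IsTorsion R H2) : Module.IsTorsion R X := by
  intro x
  obtain ⟨⟨a, ha⟩, hax⟩ := @hH2 (δ x)
  have ha0 : a ≠ 0 := nonZeroDivisors.ne_zero ha
  have hδ : δ (a • x) = 0 := by rw [map_smul]; exact hax
  obtain ⟨y, hy⟩ := hXH _ hδ
  refine ⟨⟨c * G * (c * a), mem_nonZeroDivisors_of_ne_zero
    (mul_ne_zero (mul_ne_zero hc hG) (mul_ne_zero hc ha0))⟩, ?_⟩
  rw [Submonoid.smul_def, mul_smul, mul_smul, mul_smul, ← hy, ← map_smul,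
    smul_eq_col_smul_loc loc col hcol hz y, map_smul, smul_comm, hPX, smul_zero]

omit [IsDomain R] in
/-- The exactness-free length bookkeeping of Kato's §17.13 (p. 280): with `loc` and `col`
injective and `G ∈ col (loc Z)`,
`length (P/loc H)_𝔭 + length (H/Z)_𝔭 = length (P/loc Z)_𝔭 ≤ length (R/col(loc Z))_𝔭 ≤ length (R/(G))_𝔭`.
[cite: Kato2004Asterisque, §17.13 (p. 280)] -/
theorem lengthAt_quotient_range_add_le (loc : H →ₗ[R] P) (hinj : Function.Injective loc)
    (col : P →ₗ[R] R) (hcol : Function.Injective col) (Z : Submodule R H) {G : R}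
    (hGZ : G ∈ Submodule.map (col ∘ₗ loc) Z) (𝔭 : PrimeSpectrum R) :
    lengthAt R (P ⧸ LinearMap.range loc) 𝔭 + lengthAt R (H ⧸ Z) 𝔭 ≤
      lengthAt R (R ⧸ Ideal.span {G}) 𝔭 := by
  obtain ⟨z, hzZ, hz⟩ := Submodule.mem_map.mp hGZ
  simp only [LinearMap.coe_comp, Function.comp_apply] at hz
  set LZ : Submodule R P := Submodule.map loc Z with hLZ
  have hLZle : LZ ≤ LinearMap.range loc := LinearMap.map_le_range
  -- the image `N` of `range loc` in `P / LZ`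
  set N : Submodule R (P ⧸ LZ) := Submodule.map LZ.mkQ (LinearMap.range loc) with hN
  have hQN : lengthAt R (P ⧸ LZ) 𝔭 = lengthAt R N 𝔭 + lengthAt R ((P ⧸ LZ) ⧸ N) 𝔭 :=
    lengthAt_eq_add_quotient N 𝔭
  have hthird : lengthAt R ((P ⧸ LZ) ⧸ N) 𝔭 = lengthAt R (P ⧸ LinearMap.range loc) 𝔭 :=
    lengthAt_eq_of_linearEquiv (Submodule.quotientQuotientEquivQuotient LZ _ hLZle) 𝔭
  -- `N ≃ H / Z` (`loc` injective)
  have hNeq : lengthAt R N 𝔭 = lengthAt R (H ⧸ Z) 𝔭 := by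
    set g : H →ₗ[R] P ⧸ LZ := LZ.mkQ ∘ₗ loc with hg
    have hrange : LinearMap.range g = N := by
      rw [hg, LinearMap.range_comp, hN]
    have hker : LinearMap.ker g = Z := by
      rw [hg, LinearMap.ker_comp, Submodule.ker_mkQ, hLZ, Submodule.comap_map_eq_of_injective hinj]
    calc lengthAt R N 𝔭 = lengthAt R (LinearMap.range g) 𝔭 := by rw [hrange]
      _ = lengthAt R (H ⧸ LinearMap.ker g) 𝔭 :=
          (lengthAt_eq_of_linearEquiv g.quotKerEquivRange 𝔭).symm
      _ = lengthAt R (H ⧸ Z) 𝔭 := by rw [hker]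
  -- `P / LZ ↪ R / col(LZ)` and `R/(G) ↠ R / col(LZ)`
  set I : Ideal R := Submodule.map col LZ with hI
  have hGI : G ∈ I := ⟨loc z, ⟨z, hzZ, rfl⟩, hz⟩
  have hQI : lengthAt R (P ⧸ LZ) 𝔭 ≤ lengthAt R (R ⧸ I) 𝔭 := by
    refine lengthAt_le_of_injective (Submodule.mapQ LZ I col fun y hy => ⟨y, hy, rfl⟩) ?_ 𝔭
    rw [← LinearMap.ker_eq_bot, Submodule.ker_mapQ, Submodule.comap_map_eq_of_injective hcol,
      Submodule.mkQ_map_self]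
  have hIG : lengthAt R (R ⧸ I) 𝔭 ≤ lengthAt R (R ⧸ Ideal.span {G}) 𝔭 :=
    lengthAt_le_of_surjective (Submodule.factor ((Ideal.span_singleton_le_iff_mem I).mpr hGI))
      (Submodule.factor_surjective _) 𝔭
  calc lengthAt R (P ⧸ LinearMap.range loc) 𝔭 + lengthAt R (H ⧸ Z) 𝔭
        = lengthAt R (P ⧸ LZ) 𝔭 := by rw [hQN, hthird, hNeq, add_comm]
    _ ≤ lengthAt R (R ⧸ I) 𝔭 := hQI
    _ ≤ lengthAt R (R ⧸ Ideal.span {G}) 𝔭 := hIG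

/-- **Thm. 17.4 (2) at one prime, skeleton, Poitou–Tate exact up to `×c`.** In the situation of
`isTorsion_of_skeleton_upTo`, with `H` torsion free of rank `≤ 1` (Thm. 12.4 (2)), `Z ≤ H` the
zeta submodule and `G ∈ col (loc Z)`, `G ≠ 0` (Thm. 16.6, Prop. 17.11): at every prime `𝔭 ∌ c`
where the Euler-system bound `length H2_𝔭 ≤ length (H/Z)_𝔭` of Thm. 12.5 (3) holds, one has
`length X_𝔭 ≤ length (R/(G))_𝔭`. Kato (p. 280) localises (17.13.1) at `𝔭`, where it becomes
exact because its defect is killed by `2 ∉ 𝔭`; here, equivalently, the defects have local length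
`0` at `𝔭`: `length X_𝔭 ≤ length toX(P)_𝔭 + length H2_𝔭` (`c · Ker δ ⊆ toX(P)`),
`length toX(P)_𝔭 = length (P/Ker toX)_𝔭 ≤ length (P/loc H)_𝔭` (`c · loc(H) ⊆ Ker toX`), and then
the exactness-free bookkeeping `lengthAt_quotient_range_add_le`.
[cite: Kato2004Asterisque, Thm 17.4 (2) (p. 273), §17.13 (pp. 279–280), 14.9 (p. 239)] -/
theorem lengthAt_le_of_skeleton_upTo [Module.IsTorsionFree R H] (hrank : Module.rank R H ≤ 1)
    {c : R} (loc : H →ₗ[R] P) (toX : P →ₗ[R] X) (δ : X →ₗ[R] H2)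
    (hPX : ∀ h : H, c • toX (loc h) = 0) (hXH : ∀ x : X, δ x = 0 → c • x ∈ LinearMap.range toX)
    (col : P →ₗ[R] R) (hcol : Function.Injective col) (Z : Submodule R H) {G : R} (hG : G ≠ 0)
    (hGZ : G ∈ Submodule.map (col ∘ₗ loc) Z) (𝔭 : PrimeSpectrum R) (hc : c ∉ 𝔭.asIdeal)
    (hES : lengthAt R H2 𝔭 ≤ lengthAt R (H ⧸ Z) 𝔭) :
    lengthAt R X 𝔭 ≤ lengthAt R (R ⧸ Ideal.span {G}) 𝔭 := by
  obtain ⟨z, -, hz⟩ := Submodule.mem_map.mp hGZ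
  simp only [LinearMap.coe_comp, Function.comp_apply] at hz
  have hinj : Function.Injective loc := loc_injective hrank loc col hG hz
  -- `length X ≤ length (range toX) + length H2`
  have h1 : lengthAt R X 𝔭 ≤ lengthAt R (LinearMap.range toX) 𝔭 + lengthAt R H2 𝔭 :=
    lengthAt_le_add_of_smul_ker_le δ (LinearMap.range toX) 𝔭 hc hXH
  -- `length (range toX) = length (P / ker toX) ≤ length (P / range loc)`
  have h2 : lengthAt R (LinearMap.range toX) 𝔭 ≤ lengthAt R (P ⧸ LinearMap.range loc) 𝔭 := by
    rw [← lengthAt_eq_of_linearEquiv toX.quotKerEquivRange 𝔭]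
    refine lengthAt_quotient_le_of_smul_mem 𝔭 hc ?_
    rintro _ ⟨h, rfl⟩
    rw [LinearMap.mem_ker, map_smul]
    exact hPX h
  calc lengthAt R X 𝔭 ≤ lengthAt R (LinearMap.range toX) 𝔭 + lengthAt R H2 𝔭 := h1
    _ ≤ lengthAt R (P ⧸ LinearMap.range loc) 𝔭 + lengthAt R (H ⧸ Z) 𝔭 := add_le_add h2 hES
    _ ≤ lengthAt R (R ⧸ Ideal.span {G}) 𝔭 :=
        lengthAt_quotient_range_add_le loc hinj col hcol Z hGZ 𝔭

/-- **Kato, Thm. 17.4 (1)–(2), skeleton over a domain, with (17.13.1) exact up to `×c`** — the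
module theory of §17.13 at `p = 2` ("(17.13.1) … is exact if `p ≠ 2`, and is exact upto `×2` in the
case `p = 2`", p. 279; Kato localises at the height-one `𝔭 ∌ p`, p. 280). Hypotheses as in
`thm17_4_skeleton` (file `KatoDivisibilitySkeletonProofs`) except that the Poitou–Tate maps
`H →loc P →toX X →δ H2` are only assumed to satisfy `c · toX(loc H) = 0` and `c · Ker δ ⊆ toX(P)`
for some `c ≠ 0`. Conclusion: (1) `X` is torsion; (2) at every prime `𝔭 ∌ c` at which the
Euler-system bound `length H2_𝔭 ≤ length (H/Z)_𝔭` (Thm. 12.5 (3)) holds,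
`length_{R_𝔭} X_𝔭 ≤ length_{R_𝔭} (R/(G))_𝔭 = ord_𝔭(G)`. For `c = 1` this is `thm17_4_skeleton`.
[cite: Kato2004Asterisque, Thm 17.4 (1)(2) (p. 273), §17.13 (pp. 279–280), 14.9 (p. 239)] -/
theorem thm17_4_skeleton_upTo [Module.IsTorsionFree R H] (hrank : Module.rank R H ≤ 1)
    {c : R} (hc : c ≠ 0) (loc : H →ₗ[R] P) (toX : P →ₗ[R] X) (δ : X →ₗ[R] H2)
    (hPX : ∀ h : H, c • toX (loc h) = 0) (hXH : ∀ x : X, δ x = 0 → c • x ∈ LinearMap.range toX)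
    (col : P →ₗ[R] R) (hcol : Function.Injective col) (hH2 : Module.IsTorsion R H2)
    (Z : Submodule R H) {G : R} (hG : G ≠ 0) (hGZ : G ∈ Submodule.map (col ∘ₗ loc) Z) :
    Module.IsTorsion R X ∧
      ∀ 𝔭 : PrimeSpectrum R, c ∉ 𝔭.asIdeal → lengthAt R H2 𝔭 ≤ lengthAt R (H ⧸ Z) 𝔭 →
        lengthAt R X 𝔭 ≤ lengthAt R (R ⧸ Ideal.span {G}) 𝔭 := by
  obtain ⟨z, -, hz⟩ := Submodule.mem_map.mp hGZ
  simp only [LinearMap.coe_comp, Function.comp_apply] at hz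
  exact ⟨isTorsion_of_skeleton_upTo hc loc toX δ hPX hXH col hcol hG hz hH2,
    fun 𝔭 hc𝔭 h𝔭 => lengthAt_le_of_skeleton_upTo hrank loc toX δ hPX hXH col hcol Z hG hGZ 𝔭 hc𝔭 h𝔭⟩

omit [IsDomain R] in
/-- An exact pair is exact up to `×c` for every `c` (both halves used above). [folklore] -/
theorem upTo_of_exact {c : R} (loc : H →ₗ[R] P) (toX : P →ₗ[R] X) (δ : X →ₗ[R] H2)
    (hPX : Function.Exact loc toX) (hXH : Function.Exact toX δ) :
    (∀ h : H, c • toX (loc h) = 0) ∧ ∀ x : X, δ x = 0 → c • x ∈ LinearMap.range toX := by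
  refine ⟨fun h => ?_, fun x hx => ?_⟩
  · rw [(hPX (loc h)).mpr ⟨h, rfl⟩, smul_zero]
  · obtain ⟨y, hy⟩ := (hXH x).mp hx
    exact ⟨c • y, by rw [map_smul, hy]⟩

end SkeletonUpTo

/-! ### Over `Λ = ℤ_p⟦T⟧`: the tree's form of Thm 17.4 (1)(2), defects killed by `c` -/

section Iwasawa

variable (p : ℕ) [Fact p.Prime]
  {H P X H2 H2loc : Type*} [AddCommGroup H] [_root_.Module (IwasawaAlgebra p) H]
  [AddCommGroup P] [_root_.Module (IwasawaAlgebra p) P]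
  [AddCommGroup X] [_root_.Module (IwasawaAlgebra p) X]
  [AddCommGroup H2] [_root_.Module (IwasawaAlgebra p) H2]
  [AddCommGroup H2loc] [_root_.Module (IwasawaAlgebra p) H2loc]

/-- **Kato, Thm. 17.4 (1)–(2) for `Λ = ℤ_p⟦T⟧`, in the tree's form, with (17.13.1) exact up to
`×c`.** Hypotheses as in `exists_mem_charIdeal_of_skeleton` (file `KatoDivisibilitySkeletonProofs`)
except that the Poitou–Tate maps only satisfy `c · toX(loc H) = 0`, `c · Ker δ ⊆ toX(P)` for an
element `c ≠ 0` of `Λ` lying in no height-one prime `𝔭 ∌ p` (Kato at `p = 2`: `c = 2 = p`,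
14.9 p. 239 and 17.13 p. 279; in general `c = p^a`). Conclusion: `X` is `Λ`-torsion and
`p^m · L ∈ ι(char_Λ X)` for some `m` — the length inequalities of Thm. 17.4 (2) are only needed,
and only printed, at the height-one primes NOT containing `p` (p. 273), where `c` is a unit
(bridge: `Module.exists_pow_mul_mem_charIdeal_of_lengthAt_le`).
[cite: Kato2004Asterisque, Thm 17.4 (1)(2) (p. 273), §17.13 (pp. 279–280), 14.9 (p. 239)] -/
theorem exists_mem_charIdeal_of_skeleton_upTo [Module.Finite (IwasawaAlgebra p) X]
    [Module.IsTorsionFree (IwasawaAlgebra p) H] (hrank : Module.rank (IwasawaAlgebra p) H ≤ 1)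
    {c : IwasawaAlgebra p} (hc0 : c ≠ 0)
    (hc : ∀ 𝔭 : PrimeSpectrum (IwasawaAlgebra p), 𝔭.asIdeal.height = 1 →
      PowerSeries.C (p : ℤ_[p]) ∉ 𝔭.asIdeal → c ∉ 𝔭.asIdeal)
    (loc : H →ₗ[IwasawaAlgebra p] P) (toX : P →ₗ[IwasawaAlgebra p] X)
    (δ : X →ₗ[IwasawaAlgebra p] H2) (hPX : ∀ h : H, c • toX (loc h) = 0)
    (hXH : ∀ x : X, δ x = 0 → c • x ∈ LinearMap.range toX)
    (col : P →ₗ[IwasawaAlgebra p] IwasawaAlgebra p) (hcol : Function.Injective col)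
    (hH2 : Module.IsTorsion (IwasawaAlgebra p) H2)
    (Z : Submodule (IwasawaAlgebra p) H) {G : IwasawaAlgebra p} (hG : G ≠ 0)
    (hGZ : G ∈ Submodule.map (col ∘ₗ loc) Z)
    (hES : ∀ 𝔭 : PrimeSpectrum (IwasawaAlgebra p), 𝔭.asIdeal.height = 1 →
      PowerSeries.C (p : ℤ_[p]) ∉ 𝔭.asIdeal →
        lengthAt (IwasawaAlgebra p) H2 𝔭 ≤
          lengthAt (IwasawaAlgebra p) (H ⧸ Z) 𝔭 + lengthAt (IwasawaAlgebra p) H2loc 𝔭)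
    (hH2loc : ∀ 𝔭 : PrimeSpectrum (IwasawaAlgebra p), 𝔭.asIdeal.height = 1 →
      PowerSeries.C (p : ℤ_[p]) ∉ 𝔭.asIdeal → lengthAt (IwasawaAlgebra p) H2loc 𝔭 = 0)
    {L : PowerSeries ℚ_[p]} {n : ℕ}
    (hιG : iwasawaToPowerSeries p G = PowerSeries.C ((p : ℚ_[p]) ^ n) * L) :
    Module.IsTorsion (IwasawaAlgebra p) X ∧
      ∃ (m : ℕ) (g : IwasawaAlgebra p), g ∈ charIdeal (IwasawaAlgebra p) X ∧
        iwasawaToPowerSeries p g = PowerSeries.C ((p : ℚ_[p]) ^ m) * L := by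
  obtain ⟨htors, hlen⟩ :=
    thm17_4_skeleton_upTo hrank hc0 loc toX δ hPX hXH col hcol hH2 Z hG hGZ
  refine ⟨htors, ?_⟩
  obtain ⟨m, hm⟩ := exists_pow_mul_mem_charIdeal_of_lengthAt_le htors (IwasawaAlgebra.prime_C p)
    hG fun 𝔭 h1 hp𝔭 => hlen 𝔭 (hc 𝔭 h1 hp𝔭) (by simpa [hH2loc 𝔭 h1 hp𝔭] using hES 𝔭 h1 hp𝔭)
  refine ⟨m + n, PowerSeries.C (p : ℤ_[p]) ^ m * G, hm, ?_⟩
  rw [map_mul, map_pow, hιG, PowerSeries.map_C, map_natCast, ← mul_assoc, ← map_pow, ← map_mul,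
    ← pow_add]

/-- `p^a`, as an element of `Λ = ℤ_p⟦T⟧`, is non-zero and lies in no height-one prime `𝔭 ∌ p`.
[folklore] -/
theorem natCast_pow_ne_zero_and_not_mem (a : ℕ) :
    ((p : IwasawaAlgebra p) ^ a ≠ 0) ∧
      ∀ 𝔭 : PrimeSpectrum (IwasawaAlgebra p), 𝔭.asIdeal.height = 1 →
        PowerSeries.C (p : ℤ_[p]) ∉ 𝔭.asIdeal → (p : IwasawaAlgebra p) ^ a ∉ 𝔭.asIdeal := by
  have hpC : (p : IwasawaAlgebra p) = PowerSeries.C (p : ℤ_[p]) := (map_natCast _ p).symm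
  refine ⟨pow_ne_zero a (hpC ▸ (IwasawaAlgebra.prime_C p).ne_zero), fun 𝔭 _ hp𝔭 h => hp𝔭 ?_⟩
  rw [← hpC]
  exact 𝔭.isPrime.mem_of_pow_mem a h

end Iwasawa

/-! ### For `X = X(E/ℚ_∞)` and `L = L_p(E,T)`, at ANY prime `p` -/

section Selmer

variable (W : WeierstrassCurve ℚ) [W.IsElliptic] [W.IsGloballyMinimal] (p : ℕ) [Fact p.Prime]
  {κ : ZpExtension ℚ p} {γ : Field.absoluteGaloisGroup ℚ} {N : ℕ} [NeZero N]
  {f : CuspForm (Gamma0 N) 2}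
  {H P H2 H2loc : Type*} [AddCommGroup H] [_root_.Module (IwasawaAlgebra p) H]
  [AddCommGroup P] [_root_.Module (IwasawaAlgebra p) P]
  [AddCommGroup H2] [_root_.Module (IwasawaAlgebra p) H2]
  [AddCommGroup H2loc] [_root_.Module (IwasawaAlgebra p) H2loc]

/-- **Conclusions (1)–(2) of Kato's Thm. 17.4 for `T_pE`, at ANY prime `p` (`p = 2` included),
from the four cohomological inputs of §17.13 with Poitou–Tate exact up to `×p^a`.** As
`kato_divisibility_conclusions_of_skeleton` (file `KatoDivisibilitySkeletonProofs`): for `E/ℚ`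
(globally minimal `W`), `p` good ordinary (`hord`), `f` its newform (`hf`), `κ` a cyclotomic
`ℤ_p`-extension with topological generator `γ`, `D` a Pontryagin-dual datum for `Sel_{p^∞}(E/ℚ_∞)`,
GIVEN `Λ`-modules `H, P, H2, H2loc` with the Poitou–Tate maps `H → P → D.X → H2` satisfying
`p^a · toX(loc H) = 0` and `p^a · Ker δ ⊆ toX(P)` ((17.13.1) "exact upto ×2 in the case `p = 2`",
p. 279, 14.9 p. 239; exact, hence this with any `a`, for odd `p` — `upTo_of_exact`), `H` torsion
free of rank `≤ 1` and `H2` torsion (Thm. 12.4), `col : P ↪ Λ` (Prop. 17.11), `Z ≤ H` with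
`G ∈ col (loc Z)`, `ι G = p^n L_p(E,T)` (Thm. 16.6), and the Euler-system bound of Thm. 12.5 (3) at
the height-one `𝔭 ∌ p` with vanishing `H2loc`-term — THEN `D.X` is `Λ`-torsion and
`p^m L_p(E,T) = ι g` for some `g ∈ char_Λ D.X`. (`G ≠ 0` by the tree theorem
`padicLFunction_unitRoot_ne_zero`, Rohrlich.)
[cite: Kato2004Asterisque, Thm 17.4 (1)(2) (p. 273), §17.13 (pp. 279–280), 14.9 (p. 239)] -/
theorem kato_divisibility_conclusions_of_skeleton_upTo (hord : IsOrdinaryAt W p)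
    (hf : IsNewformOf W f) (hκ : κ.IsCyclotomic) (hγ : κ.IsTopGenerator γ)
    (D : W.SelmerDualData κ γ) [Module.IsTorsionFree (IwasawaAlgebra p) H]
    (hrank : Module.rank (IwasawaAlgebra p) H ≤ 1) {a : ℕ}
    (loc : H →ₗ[IwasawaAlgebra p] P) (toX : P →ₗ[IwasawaAlgebra p] D.X)
    (δ : D.X →ₗ[IwasawaAlgebra p] H2)
    (hPX : ∀ h : H, ((p : IwasawaAlgebra p) ^ a) • toX (loc h) = 0)
    (hXH : ∀ x : D.X, δ x = 0 → ((p : IwasawaAlgebra p) ^ a) • x ∈ LinearMap.range toX)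
    (col : P →ₗ[IwasawaAlgebra p] IwasawaAlgebra p) (hcol : Function.Injective col)
    (hH2 : Module.IsTorsion (IwasawaAlgebra p) H2)
    (Z : Submodule (IwasawaAlgebra p) H) {G : IwasawaAlgebra p}
    (hGZ : G ∈ Submodule.map (col ∘ₗ loc) Z)
    (hES : ∀ 𝔭 : PrimeSpectrum (IwasawaAlgebra p), 𝔭.asIdeal.height = 1 →
      PowerSeries.C (p : ℤ_[p]) ∉ 𝔭.asIdeal →
        lengthAt (IwasawaAlgebra p) H2 𝔭 ≤
          lengthAt (IwasawaAlgebra p) (H ⧸ Z) 𝔭 + lengthAt (IwasawaAlgebra p) H2loc 𝔭)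
    (hH2loc : ∀ 𝔭 : PrimeSpectrum (IwasawaAlgebra p), 𝔭.asIdeal.height = 1 →
      PowerSeries.C (p : ℤ_[p]) ∉ 𝔭.asIdeal → lengthAt (IwasawaAlgebra p) H2loc 𝔭 = 0)
    {n : ℕ} (hιG : iwasawaToPowerSeries p G =
      PowerSeries.C ((p : ℚ_[p]) ^ n) * padicLFunction f (unitRoot W p : ℚ_[p])) :
    D.IsTorsion ∧
      ∃ (m : ℕ) (g : IwasawaAlgebra p), g ∈ D.charIdeal ∧
        iwasawaToPowerSeries p g =
          PowerSeries.C ((p : ℚ_[p]) ^ m) * padicLFunction f (unitRoot W p : ℚ_[p]) := by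
  haveI : Module.Finite (IwasawaAlgebra p) D.X := D.module_finite_of_isCyclotomic W κ hκ hγ
  have hG : G ≠ 0 := by
    intro hG0
    have hL := padicLFunction_unitRoot_ne_zero hord hf
    have hpn : PowerSeries.C ((p : ℚ_[p]) ^ n) ≠ 0 := by
      rw [Ne, map_eq_zero_iff _ (PowerSeries.C_injective), pow_eq_zero_iff']
      exact fun h => (Nat.cast_ne_zero.mpr (Fact.out : p.Prime).ne_zero) h.1
    rw [hG0, map_zero, eq_comm, mul_eq_zero] at hιG
    exact hιG.elim hpn hL
  obtain ⟨hc0, hc⟩ := natCast_pow_ne_zero_and_not_mem p a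
  exact exists_mem_charIdeal_of_skeleton_upTo p hrank hc0 hc loc toX δ hPX hXH col hcol hH2 Z hG
    hGZ hES hH2loc hιG

end Selmer

end Kato2004

/-! ### Thm. 18.4 at every prime from the four inputs of §17.13 -/

section RankBoundAllPrimes

variable (W : WeierstrassCurve ℚ) [W.IsElliptic] [W.IsGloballyMinimal] (p : ℕ) [Fact p.Prime]
  {κ : ZpExtension ℚ p} {γ : Field.absoluteGaloisGroup ℚ} {N : ℕ} [NeZero N]
  {f : CuspForm (Gamma0 N) 2}
  {H P H2 H2loc : Type*} [AddCommGroup H] [_root_.Module (IwasawaAlgebra p) H]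
  [AddCommGroup P] [_root_.Module (IwasawaAlgebra p) P]
  [AddCommGroup H2] [_root_.Module (IwasawaAlgebra p) H2]
  [AddCommGroup H2loc] [_root_.Module (IwasawaAlgebra p) H2loc]

/-- **What remains for Kato's Thm. 18.4 at EVERY good ordinary prime (`p = 2` included).** For
`E/ℚ` (globally minimal `W`) good ordinary at the prime `p` (`hord`) with newform `f` (`hf`), the
conclusion `corank_{ℤ_p} Sel_{p^∞}(E/ℚ) ≤ ord_{T=0} L_p(E,T)` of the named fact
`kato_selmerCorank_le_order_padicLFunction_allPrimes W p` follows from the four cohomological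
inputs of Kato's §17.13 on ONE cyclotomic datum `(κ, γ, D)` — the Poitou–Tate maps
`H → P → D.X → H2` **exact up to `×p^a`** ((17.13.1): exact for `p ≠ 2`, "exact upto `×2`" for
`p = 2`, p. 279), `H` torsion free of rank `≤ 1` and `H2` torsion (Thm. 12.4), an injective
`col : P → Λ` with a zeta submodule `Z ≤ H` whose image contains `G`, `ι G = p^n L_p(E,T)`
(Prop. 17.11, Thm. 16.6), and the Euler-system bound of Thm. 12.5 (3) at the height-one `𝔭 ∌ p`
— everything else being PROVED, parity-free theorems of the tree:
`Kato2004.kato_divisibility_conclusions_of_skeleton_upTo` (Thm. 17.4 (1)(2) at `p`), then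
`selmerCorank_le_order_of_charIdeal_datum` (18.4 ⇐ 17.4: `corank Sel ≤ rank X/TX ≤ ord_T g ≤
ord_T ι g = ord_T L_p`). In particular the all-primes Thm. 18.4 requires no input beyond those of
the odd-`p` case. [cite: Kato2004Asterisque, §17.13 (pp. 279–280), Thm 17.4 (p. 273), Thm 18.4 (p. 281), 14.9 (p. 239)] -/
theorem kato_selmerCorank_le_order_padicLFunction_allPrimes_of_skeleton (hord : IsOrdinaryAt W p)
    (hf : IsNewformOf W f) (hκ : κ.IsCyclotomic) (hγ : κ.IsTopGenerator γ)
    (D : W.SelmerDualData κ γ) [Module.IsTorsionFree (IwasawaAlgebra p) H]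
    (hrank : Module.rank (IwasawaAlgebra p) H ≤ 1) {a : ℕ}
    (loc : H →ₗ[IwasawaAlgebra p] P) (toX : P →ₗ[IwasawaAlgebra p] D.X)
    (δ : D.X →ₗ[IwasawaAlgebra p] H2)
    (hPX : ∀ h : H, ((p : IwasawaAlgebra p) ^ a) • toX (loc h) = 0)
    (hXH : ∀ x : D.X, δ x = 0 → ((p : IwasawaAlgebra p) ^ a) • x ∈ LinearMap.range toX)
    (col : P →ₗ[IwasawaAlgebra p] IwasawaAlgebra p) (hcol : Function.Injective col)
    (hH2 : Module.IsTorsion (IwasawaAlgebra p) H2)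
    (Z : Submodule (IwasawaAlgebra p) H) {G : IwasawaAlgebra p}
    (hGZ : G ∈ Submodule.map (col ∘ₗ loc) Z)
    (hES : ∀ 𝔭 : PrimeSpectrum (IwasawaAlgebra p), 𝔭.asIdeal.height = 1 →
      PowerSeries.C (p : ℤ_[p]) ∉ 𝔭.asIdeal →
        Module.lengthAt (IwasawaAlgebra p) H2 𝔭 ≤
          Module.lengthAt (IwasawaAlgebra p) (H ⧸ Z) 𝔭 +
            Module.lengthAt (IwasawaAlgebra p) H2loc 𝔭)
    (hH2loc : ∀ 𝔭 : PrimeSpectrum (IwasawaAlgebra p), 𝔭.asIdeal.height = 1 →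
      PowerSeries.C (p : ℤ_[p]) ∉ 𝔭.asIdeal → Module.lengthAt (IwasawaAlgebra p) H2loc 𝔭 = 0)
    {n : ℕ} (hιG : iwasawaToPowerSeries p G =
      PowerSeries.C ((p : ℚ_[p]) ^ n) * padicLFunction f (unitRoot W p : ℚ_[p])) :
    (W.selmerCorank p : ℕ∞) ≤ (padicLFunction f (unitRoot W p : ℚ_[p])).order := by
  haveI : Module.Finite (IwasawaAlgebra p) D.X := D.module_finite_of_isCyclotomic W κ hκ hγ
  obtain ⟨htors, m, g, hg, hιg⟩ := Kato2004.kato_divisibility_conclusions_of_skeleton_upTo W p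
    hord hf hκ hγ D hrank loc toX δ hPX hXH col hcol hH2 Z hGZ hES hH2loc hιG
  exact selmerCorank_le_order_of_charIdeal_datum W p hγ D htors hg hιg

/-- The named fact `kato_selmerCorank_le_order_padicLFunction_allPrimes W p` itself (Kato's
Thm. 18.4 at the prime `p`, any parity) from the four inputs of §17.13 on one cyclotomic datum,
Poitou–Tate exact up to `×p^a` (`kato_selmerCorank_le_order_padicLFunction_allPrimes_of_skeleton`).
[cite: Kato2004Asterisque, §17.13 (pp. 279–280), Thm 17.4 (p. 273), Thm 18.4 (p. 281)] -/
theorem kato_selmerCorank_le_order_padicLFunction_allPrimes_of_skeleton'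
    (hκ : κ.IsCyclotomic) (hγ : κ.IsTopGenerator γ)
    (D : W.SelmerDualData κ γ) [Module.IsTorsionFree (IwasawaAlgebra p) H]
    (hrank : Module.rank (IwasawaAlgebra p) H ≤ 1) {a : ℕ}
    (loc : H →ₗ[IwasawaAlgebra p] P) (toX : P →ₗ[IwasawaAlgebra p] D.X)
    (δ : D.X →ₗ[IwasawaAlgebra p] H2)
    (hPX : ∀ h : H, ((p : IwasawaAlgebra p) ^ a) • toX (loc h) = 0)
    (hXH : ∀ x : D.X, δ x = 0 → ((p : IwasawaAlgebra p) ^ a) • x ∈ LinearMap.range toX)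
    (col : P →ₗ[IwasawaAlgebra p] IwasawaAlgebra p) (hcol : Function.Injective col)
    (hH2 : Module.IsTorsion (IwasawaAlgebra p) H2)
    (Z : Submodule (IwasawaAlgebra p) H) {G : IwasawaAlgebra p}
    (hGZ : G ∈ Submodule.map (col ∘ₗ loc) Z)
    (hES : ∀ 𝔭 : PrimeSpectrum (IwasawaAlgebra p), 𝔭.asIdeal.height = 1 →
      PowerSeries.C (p : ℤ_[p]) ∉ 𝔭.asIdeal →
        Module.lengthAt (IwasawaAlgebra p) H2 𝔭 ≤
          Module.lengthAt (IwasawaAlgebra p) (H ⧸ Z) 𝔭 +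
            Module.lengthAt (IwasawaAlgebra p) H2loc 𝔭)
    (hH2loc : ∀ 𝔭 : PrimeSpectrum (IwasawaAlgebra p), 𝔭.asIdeal.height = 1 →
      PowerSeries.C (p : ℤ_[p]) ∉ 𝔭.asIdeal → Module.lengthAt (IwasawaAlgebra p) H2loc 𝔭 = 0)
    {n : ℕ} (hιG : iwasawaToPowerSeries p G =
      PowerSeries.C ((p : ℚ_[p]) ^ n) * padicLFunction f (unitRoot W p : ℚ_[p])) :
    kato_selmerCorank_le_order_padicLFunction_allPrimes W p (f := f) :=
  fun hord hf => kato_selmerCorank_le_order_padicLFunction_allPrimes_of_skeleton W p hord hf hκ hγ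
    D hrank loc toX δ hPX hXH col hcol hH2 Z hGZ hES hH2loc hιG

end RankBoundAllPrimes

end Literature.NumberTheory.EllipticCurves
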